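/-
Copyright (c) 2026 the pub-hodgecm-mathlib formalisation cell (harness21).  Prover seat hodgecm-mathlib-K2E5-p08 (g2), Track B «K2-LIT» ∕ h413,
engine E5 «TamagawaUnitary», unit G: DEFS LEAF — the FINITE-ADELIC reduced norm `Nrd_f = det : (D_h ⊗ 𝔸_{L⁺,f})^× →* (𝔸_{L,f})^×`, the `c ⊗ 1`-fixed finite idèle units,
the image, the kernel, and the compatibility with the global `Nrd` along ★ #3m `quatFinPart`.  2026-09-04.
-/
import Summits.HodgeConjecture.HodgeConjecture.Theorems.K2E5QuatAdelicProdDecomposition   -- ★ #3m ED. 2 (p855902, K2E5-p04): `quatFinAdelicUnits`, `quatFinPart`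
import Summits.HodgeConjecture.HodgeConjecture.Theorems.K2E5QuatAdelicNrdDefs             -- ★ #3i (p855344, K2E5-p10): `quatAdelicNrd` (global twin)
import HarnessLib

/-!
# K2 ∕ E5 «TamagawaUnitary» — DEFS LEAF `K2E5QuatFinNrdDefs`: the finite-adelic reduced norm `quatFinNrd = det : (D_h ⊗ 𝔸_{L⁺,f})^× →* (𝔸_{L,f})^×`,
# the `c ⊗ 1`-fixed finite idèle units `fixedFinAdelicUnits L` (= `(𝔸_{L⁺,f})^×` inside `(𝔸_{L,f})^×`), the image `quatFinNrdImage`, the kernel, and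
# the compatibility `Nrd_f (x_f) = (Nrd x)_f` with ★ #3i `quatAdelicNrd` along ★ #3m `quatFinPart`

Cell `hodgecm-mathlib` (Track B «K2-LIT»), engine E5, item h413 = `stmt-HodgeConjecture-24833` (`--kind definition --supports … --as helper`); dealt BY NAME by
K2E5-plan (g2), SWEEP #12 (2026-09-04T00:02:50Z) item (23) («(i)+(iii) of K2E5-p17's G13-fin census»); author K2E5-p08 (g2).  DEFINITIONS WITH BODIES +
unfolding ∕ closedness ∕ containment ∕ compatibility lemmas only (no `sorry`, no axiom beyond the trio, no `instance`, no `notation`, no binder-less `def … : Prop`).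
The FINITE twin of ★ #3i `K2E5QuatAdelicNrdDefs` (same shapes, `𝔸_L` ↦ `𝔸_{L,f}`, ★ `adeleConj` ↦ ★ `conjFiniteAdele`).

THE OBJECTS ([VignerasLNM800, Ch. III §1 (`X_A^× = X_∞^× × X_f^×`, `n_A`), §2 (`H¹_A = ker n_A`)]; [BorelJacquet1979, §4.1 (`G(𝔸) = G_∞ × G(𝔸_f)`)];
[CasselsFrohlichANT1967, Ch. II §14, §16]; [PlatonovRapinchuk1994, §5.1]).
* §1 **`fixedFinAdelicUnits L ≤ (𝔸_{L,f})^×`** := the finite idèle units fixed by `c ⊗ 1` (★ `conjFiniteAdele`; Mathlib `MonoidHom.eqLocus`) — `(𝔸_{L⁺,f})^×` diagonally — CLOSED.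
* §2 **`quatFinNrd L Ha : ↥(quatFinAdelicUnits L Ha) →* (𝔸_{L,f})^×`**, `x ↦ det x` (★ #3m `quatFinAdelicUnits`); continuity; `conjFiniteAdele (det x) = det x` on the finite model
  (`det h ≠ 0`; determinants in `((c⊗1)x)ᵀ h_f = h_f adj x`, `det h_f` a unit), so **`quatFinNrd_mem_fixedFinAdelicUnits`**; the IMAGE subgroup **`quatFinNrdImage L Ha := range`**
  and the ranged map **`quatFinNrdToImage`** (surjective by construction, continuous); the kernel is CLOSED.
* §3 **COMPATIBILITY `Nrd_f (x_f) = (Nrd x)_f`**: `(quatFinNrd (quatFinPart x) : 𝔸_{L,f}) = ((quatAdelicNrd x : 𝕀_L) : 𝔸_L).2` (★ `GLn.sndHom` is the finite projection;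
  Mathlib `RingHom.map_det`), and its `Units` form.
-- TODO (next edition, proof lane, K2E5-p08): SURJECTIVITY `range quatFinNrd = fixedFinAdelicUnits` (local surjectivity at EVERY finite place ★ `K2E5QuatLocalNrdSurjective`
-- + integral surjectivity at almost all places ★ `K2E5QuatLocalDetImage` + the restricted product ★ #3m `quatFinAdelicEquiv`) and `IsOpenMap quatFinNrdToImage`
-- (open mapping theorem, as in ★ `K2E5QuatAdelicNrdSurjectiveOpen`).

HONEST LABEL: HC_CM is proved only modulo the 7 printed citations (2 remaining named inputs: hLiu418 = stmt-HodgeConjecture-24832,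
h413 = stmt-HodgeConjecture-24833) until rung 0 closes; this file NAMES the finite reduced-norm data and asserts nothing toward any count.

## References
* [VignerasLNM800] M.-F. Vignéras, *Arithmétique des algèbres de quaternions*, LNM 800 (1980) — Ch. III §1, §2.
* [BorelJacquet1979] A. Borel, H. Jacquet, *Automorphic forms and automorphic representations*, Corvallis PSPM 33.1 (1979) — §4.1.
* [CasselsFrohlichANT1967] J. W. S. Cassels, A. Fröhlich (eds.), *Algebraic Number Theory* (1967) — Ch. II §14, §16.
* [PlatonovRapinchuk1994] V. Platonov, A. Rapinchuk, *Algebraic Groups and Number Theory* (1994) — §5.1.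
-/

set_option autoImplicit false
set_option linter.dupNamespace false

noncomputable section

namespace Summit.HodgeConjecture.HodgeConjecture.Cruxes.H413.K2E5QuatFinNrd

open NumberField IsDedekindDomain
open Literature.NumberTheory.Automorphic Literature.NumberTheory.Automorphic.UnitaryGroup
open Summit.HodgeConjecture.HodgeConjecture.Cruxes.H413.K2E5QuatAdelicMatrixModel
open Summit.HodgeConjecture.HodgeConjecture.Cruxes.H413.K2E5QuatAdelicRestrictedProduct
open Summit.HodgeConjecture.HodgeConjecture.Cruxes.H413.K2E5QuatAdelicProdDecomposition
open Summit.HodgeConjecture.HodgeConjecture.Cruxes.H413.K2E5QuatAdelicNrd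
open scoped Matrix MatrixGroups

variable (L : Type) [Field L] [NumberField L] [IsCMField L] (Ha : Matrix (Fin 2) (Fin 2) L)

/-! ## §1 The `c ⊗ 1`-fixed finite idèle units `(𝔸_{L⁺,f})^× ≤ (𝔸_{L,f})^×` -/

/-- **`(𝔸_{L⁺,f})^×` inside `(𝔸_{L,f})^×`**: the finite idèle units of `L` fixed by `c ⊗ 1` (★ `conjFiniteAdele`) — the equaliser of `Units.map (c ⊗ 1)` and the identity; the finite
twin of ★ #3i `fixedAdelicUnits`. [cite: CasselsFrohlichANT1967, Ch. II §14] [cite: VignerasLNM800, Ch. III §1] -/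
def fixedFinAdelicUnits : Subgroup (FiniteAdeleRing (𝓞 L) L)ˣ :=
  (Units.map ((conjFiniteAdele (↥(maximalRealSubfield L)) L (IsCMField.complexConj L) : FiniteAdeleRing (𝓞 L) L →+* FiniteAdeleRing (𝓞 L) L) :
      FiniteAdeleRing (𝓞 L) L →* FiniteAdeleRing (𝓞 L) L)).eqLocus (MonoidHom.id (FiniteAdeleRing (𝓞 L) L)ˣ)

/-- `t ∈ (𝔸_{L⁺,f})^× ↔ (c ⊗ 1) t = t`. [cite: CasselsFrohlichANT1967, Ch. II §14] -/
theorem mem_fixedFinAdelicUnits_iff (t : (FiniteAdeleRing (𝓞 L) L)ˣ) :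
    t ∈ fixedFinAdelicUnits L ↔ conjFiniteAdele (↥(maximalRealSubfield L)) L (IsCMField.complexConj L) (t : FiniteAdeleRing (𝓞 L) L) = t := by
  show Units.map _ t = t ↔ _
  rw [Units.ext_iff, Units.coe_map, MonoidHom.coe_coe]

/-- `(𝔸_{L⁺,f})^×` is closed in `(𝔸_{L,f})^×` (equaliser of continuous maps into a Hausdorff space). [cite: PlatonovRapinchuk1994, §5.1] -/
theorem isClosed_fixedFinAdelicUnits : IsClosed ((fixedFinAdelicUnits L : Subgroup (FiniteAdeleRing (𝓞 L) L)ˣ) : Set (FiniteAdeleRing (𝓞 L) L)ˣ) := by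
  haveI : T2Space (FiniteAdeleRing (𝓞 L) L) := inferInstanceAs (T2Space (RestrictedProduct
    (fun v : HeightOneSpectrum (𝓞 L) => v.adicCompletion L) (fun v => (v.adicCompletionIntegers L : Set (v.adicCompletion L))) Filter.cofinite))
  have h : ((fixedFinAdelicUnits L : Subgroup (FiniteAdeleRing (𝓞 L) L)ˣ) : Set (FiniteAdeleRing (𝓞 L) L)ˣ) =
      {t : (FiniteAdeleRing (𝓞 L) L)ˣ | conjFiniteAdele (↥(maximalRealSubfield L)) L (IsCMField.complexConj L) (t : FiniteAdeleRing (𝓞 L) L) = (t : FiniteAdeleRing (𝓞 L) L)} :=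
    Set.ext fun t => mem_fixedFinAdelicUnits_iff L t
  rw [h]
  exact isClosed_eq ((continuous_conjFiniteAdele (↥(maximalRealSubfield L)) L (IsCMField.complexConj L)).comp Units.continuous_val) Units.continuous_val

/-! ## §2 The finite reduced norm `Nrd_f = det`, its values, image and kernel -/

/-- **The finite-adelic reduced norm `Nrd_f : (D_h ⊗ 𝔸_{L⁺,f})^× →* (𝔸_{L,f})^×`, `x ↦ det x`** (Mathlib `GeneralLinearGroup.det` restricted to ★ #3m `quatFinAdelicUnits`; on `M₂` the reduced norm is
the determinant).  The finite twin of ★ #3i `quatAdelicNrd`. [cite: VignerasLNM800, Ch. I §1 p. 3; Ch. III §1 (n_A)] -/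
def quatFinNrd : ↥(quatFinAdelicUnits L Ha) →* (FiniteAdeleRing (𝓞 L) L)ˣ :=
  (Matrix.GeneralLinearGroup.det : GL (Fin 2) (FiniteAdeleRing (𝓞 L) L) →* (FiniteAdeleRing (𝓞 L) L)ˣ).comp (quatFinAdelicUnits L Ha).subtype

/-- `Nrd_f x = det x`. [cite: VignerasLNM800, Ch. I §1 p. 3] -/
theorem quatFinNrd_apply (x : ↥(quatFinAdelicUnits L Ha)) :
    quatFinNrd L Ha x = Matrix.GeneralLinearGroup.det (x : GL (Fin 2) (FiniteAdeleRing (𝓞 L) L)) := rfl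

/-- The finite adèle underlying `Nrd_f x` is `det x`. [cite: VignerasLNM800, Ch. I §1 p. 3] -/
theorem coe_quatFinNrd (x : ↥(quatFinAdelicUnits L Ha)) :
    ((quatFinNrd L Ha x : (FiniteAdeleRing (𝓞 L) L)ˣ) : FiniteAdeleRing (𝓞 L) L) = (x : GL (Fin 2) (FiniteAdeleRing (𝓞 L) L)).val.det := rfl

/-- `Nrd_f` is continuous. [cite: PlatonovRapinchuk1994, §5.1] -/
theorem continuous_quatFinNrd : Continuous (quatFinNrd L Ha) :=
  Matrix.GeneralLinearGroup.continuous_det.comp continuous_subtype_val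

omit [IsCMField L] in
/-- `det h_f` is a unit (`det h ≠ 0` in the field `L`). [folklore] -/
theorem isUnit_det_finiteAdelicForm (hdet : Ha.det ≠ 0) : IsUnit (finiteAdelicForm L 2 Ha).det := by
  rw [finiteAdelicForm, ← RingHom.mapMatrix_apply, ← RingHom.map_det]
  exact (isUnit_iff_ne_zero.2 hdet).map _

/-- **`det x` is `c ⊗ 1`-fixed for `x` in the finite model** (`det h ≠ 0`): determinants in `((c⊗1)x)ᵀ h_f = h_f adj x` give `(c⊗1)(det x) · det h_f = det h_f · det x`.
[cite: VignerasLNM800, Ch. III §1 (n_A : X_A^× → K_A^×)] -/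
theorem conjFiniteAdele_det_eq_det (hdet : Ha.det ≠ 0) (x : ↥(quatFinAdelicUnits L Ha)) :
    conjFiniteAdele (↥(maximalRealSubfield L)) L (IsCMField.complexConj L) (x : GL (Fin 2) (FiniteAdeleRing (𝓞 L) L)).val.det =
      (x : GL (Fin 2) (FiniteAdeleRing (𝓞 L) L)).val.det := by
  have h := congrArg Matrix.det ((mem_quatFinAdelicUnits_iff L Ha _).1 x.2)
  rw [Matrix.det_mul, Matrix.det_mul, Matrix.det_transpose, Matrix.det_adjugate, Fintype.card_fin] at h
  have hmap : ((x : GL (Fin 2) (FiniteAdeleRing (𝓞 L) L)).val.map (conjFiniteAdele (↥(maximalRealSubfield L)) L (IsCMField.complexConj L))).det =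
      conjFiniteAdele (↥(maximalRealSubfield L)) L (IsCMField.complexConj L) (x : GL (Fin 2) (FiniteAdeleRing (𝓞 L) L)).val.det := by
    rw [RingHom.map_det, RingHom.mapMatrix_apply]
  rw [hmap, show (2 : ℕ) - 1 = 1 from rfl, pow_one, mul_comm (finiteAdelicForm L 2 Ha).det] at h
  exact (isUnit_det_finiteAdelicForm L Ha hdet).mul_right_cancel h

/-- **`Nrd_f` takes values in `(𝔸_{L⁺,f})^×`** (`det h ≠ 0`). [cite: VignerasLNM800, Ch. III §1] -/
theorem quatFinNrd_mem_fixedFinAdelicUnits (hdet : Ha.det ≠ 0) (x : ↥(quatFinAdelicUnits L Ha)) : quatFinNrd L Ha x ∈ fixedFinAdelicUnits L := by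
  rw [mem_fixedFinAdelicUnits_iff, coe_quatFinNrd]
  exact conjFiniteAdele_det_eq_det L Ha hdet x

/-- As homomorphisms: `range Nrd_f ≤ (𝔸_{L⁺,f})^×`. [cite: VignerasLNM800, Ch. III §1] -/
theorem range_quatFinNrd_le_fixedFinAdelicUnits (hdet : Ha.det ≠ 0) : (quatFinNrd L Ha).range ≤ fixedFinAdelicUnits L := by
  rintro _ ⟨x, rfl⟩
  exact quatFinNrd_mem_fixedFinAdelicUnits L Ha hdet x

/-- **The image `Nrd_f((D_h ⊗ 𝔸_{L⁺,f})^×) ≤ (𝔸_{L,f})^×`** (a subgroup of `(𝔸_{L⁺,f})^×` by `range_quatFinNrd_le_fixedFinAdelicUnits`; equality with `(𝔸_{L⁺,f})^×` — local surjectivity at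
every finite place, ★ `K2E5QuatLocalNrdSurjective`, assembled over the restricted product — is the next edition). [cite: VignerasLNM800, Ch. III §1; Ch. II §1 Lemme 1.4] -/
def quatFinNrdImage : Subgroup (FiniteAdeleRing (𝓞 L) L)ˣ :=
  (quatFinNrd L Ha).range

/-- Unfolding of `quatFinNrdImage`. [cite: VignerasLNM800, Ch. III §1] -/
theorem mem_quatFinNrdImage_iff (t : (FiniteAdeleRing (𝓞 L) L)ˣ) : t ∈ quatFinNrdImage L Ha ↔ ∃ x, quatFinNrd L Ha x = t :=
  Iff.rfl

/-- **The ranged finite reduced norm `Nrd_f : (D_h ⊗ 𝔸_{L⁺,f})^× →* Nrd_f(…)`** (`MonoidHom.rangeRestrict`). [cite: VignerasLNM800, Ch. III §1] -/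
def quatFinNrdToImage : ↥(quatFinAdelicUnits L Ha) →* ↥(quatFinNrdImage L Ha) :=
  (quatFinNrd L Ha).rangeRestrict

/-- The finite idèle unit underlying `quatFinNrdToImage x` is `Nrd_f x` (definitional). [cite: VignerasLNM800, Ch. III §1] -/
theorem coe_quatFinNrdToImage (x : ↥(quatFinAdelicUnits L Ha)) :
    ((quatFinNrdToImage L Ha x : ↥(quatFinNrdImage L Ha)) : (FiniteAdeleRing (𝓞 L) L)ˣ) = quatFinNrd L Ha x := rfl

/-- `quatFinNrdToImage` is surjective (by construction). [folklore] -/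
theorem quatFinNrdToImage_surjective : Function.Surjective (quatFinNrdToImage L Ha) :=
  MonoidHom.rangeRestrict_surjective _

/-- `quatFinNrdToImage` is continuous. [cite: PlatonovRapinchuk1994, §5.1] -/
theorem continuous_quatFinNrdToImage : Continuous (quatFinNrdToImage L Ha) :=
  (continuous_quatFinNrd L Ha).subtype_mk _

/-- `ker quatFinNrdToImage = ker Nrd_f` (`SL₁(D_h)(𝔸_{L⁺,f})`). [cite: VignerasLNM800, Ch. III §2 (H¹_A = ker n_A)] -/
theorem ker_quatFinNrdToImage : (quatFinNrdToImage L Ha).ker = (quatFinNrd L Ha).ker :=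
  MonoidHom.ker_rangeRestrict _

/-- Membership in `ker Nrd_f`: `det x = 1`. [cite: VignerasLNM800, Ch. III §2] -/
theorem mem_ker_quatFinNrd_iff (x : ↥(quatFinAdelicUnits L Ha)) :
    x ∈ (quatFinNrd L Ha).ker ↔ Matrix.GeneralLinearGroup.det (x : GL (Fin 2) (FiniteAdeleRing (𝓞 L) L)) = 1 :=
  MonoidHom.mem_ker

/-- `ker Nrd_f` is closed. [cite: PlatonovRapinchuk1994, §5.1] -/
theorem isClosed_ker_quatFinNrd : IsClosed (((quatFinNrd L Ha).ker : Subgroup ↥(quatFinAdelicUnits L Ha)) : Set ↥(quatFinAdelicUnits L Ha)) := by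
  haveI : T2Space (FiniteAdeleRing (𝓞 L) L) := inferInstanceAs (T2Space (RestrictedProduct
    (fun v : HeightOneSpectrum (𝓞 L) => v.adicCompletion L) (fun v => (v.adicCompletionIntegers L : Set (v.adicCompletion L))) Filter.cofinite))
  rw [MonoidHom.coe_ker]
  exact isClosed_singleton.preimage (continuous_quatFinNrd L Ha)

/-! ## §3 Compatibility with the global reduced norm along `quatFinPart` -/

/-- **`Nrd_f (x_f) = (Nrd x)_f`**: the finite reduced norm of the finite part (★ #3m `quatFinPart`) of `x ∈ (D_h ⊗ 𝔸)^×` is the finite part of its global reduced norm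
(★ #3i `quatAdelicNrd`; `det` commutes with the projection `𝔸_L → 𝔸_{L,f}`, Mathlib `RingHom.map_det`). [cite: BorelJacquet1979, §4.1] [cite: VignerasLNM800, Ch. III §1] -/
theorem coe_quatFinNrd_quatFinPart (x : ↥(quatAdelicUnits L Ha)) :
    ((quatFinNrd L Ha (quatFinPart L Ha x) : (FiniteAdeleRing (𝓞 L) L)ˣ) : FiniteAdeleRing (𝓞 L) L) =
      (((quatAdelicNrd L Ha x : (AdeleRing (𝓞 L) L)ˣ) : AdeleRing (𝓞 L) L)).2 := by
  rw [coe_quatFinNrd, coe_quatAdelicNrd]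
  exact (RingHom.map_det (RingHom.snd (InfiniteAdeleRing L) (FiniteAdeleRing (𝓞 L) L)) _).symm

/-- `Units` form of the compatibility: `Nrd_f (x_f) = det (x_f)` with `x_f = GLn.sndHom x` (★). [cite: BorelJacquet1979, §4.1] -/
theorem quatFinNrd_quatFinPart (x : ↥(quatAdelicUnits L Ha)) :
    quatFinNrd L Ha (quatFinPart L Ha x) = Matrix.GeneralLinearGroup.det (GLn.sndHom 2 L (x : GL (Fin 2) (AdeleRing (𝓞 L) L))) := rfl

end Summit.HodgeConjecture.HodgeConjecture.Cruxes.H413.K2E5QuatFinNrd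

end
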